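import Literature.NumberTheory.EllipticCurves.AbelianVarietyBridgeFullProofs
import HarnessLib

/-!
# Elliptic curves are abelian varieties: `nonempty_abelianVarietyBridge` holds

Discharge of the named facts `WeierstrassCurve.nonempty_abelianVarietyBridge` and
`WeierstrassCurve.nonempty_abelianVarietyBridge_symm` (`EllipticCurves/AbelianVarietyBridge`) from the
full bridge fact, itself discharged in `EllipticCurves/AbelianVarietyBridgeFullProofs`
(`nonempty_abelianVarietyBridgeFull_holds`: the plane cubic `E_W ⊂ ℙ²_K` with the addition morphism
`W.addHom` glued from the Bosma–Lenstra law charts (`EllipticCurves/WeierstrassAddLawCharts`,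
`WeierstrassAddAtlas`) and the negation morphism `W.negHom` (`EllipticCurves/WeierstrassSchemeNeg`) is
an abelian-variety model of `W` (`EllipticCurves/AbelianVarietyModelOfAddHom`), and homomorphisms of
models are isogenies (`EllipticCurves/AbelianVarietyModelIsogeny`)), through the reductions
`nonempty_abelianVarietyBridge_of_full` / `nonempty_abelianVarietyBridge_symm_of_full` of
`EllipticCurves/AbelianVarietyBridgeFull`. Silverman, *AEC* III.3.1(c), III.3.6 ("an elliptic curve is
an abelian variety of dimension one") with III.4.8–4.9.

## References

* J. H. Silverman, *The Arithmetic of Elliptic Curves*, 2nd ed., GTM 106 (2009): III.3.1(c), III.3.6,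
  III.4.8, III.4.9. [SilvermanAEC2009]
-/

noncomputable section

universe u

namespace WeierstrassCurve

variable {K : Type u} [Field K] (W W' : WeierstrassCurve K)

/-- **`nonempty_abelianVarietyBridge` holds**: for elliptic curves `W, W'` over a perfect field `K`
there are abelian varieties `A, A'` over `K` with `Γ_K`-equivariant identifications `A(K̄) ≅ W(K̄)`,
`A'(K̄) ≅ W'(K̄)` under which the non-zero `K`-homomorphisms `A → A'` are isogenies `W → W'`
(Silverman, *AEC* III.3.1(c), III.3.6, III.4.8–4.9). [cite: SilvermanAEC2009, III.3.6] -/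
theorem nonempty_abelianVarietyBridge_holds : nonempty_abelianVarietyBridge W W' :=
  nonempty_abelianVarietyBridge_of_full W W' (nonempty_abelianVarietyBridgeFull_holds W W')

/-- **`nonempty_abelianVarietyBridge_symm` holds** (the same bridge data serve the homomorphisms in
both directions and the endomorphisms). [cite: SilvermanAEC2009, III.3.6] -/
theorem nonempty_abelianVarietyBridge_symm_holds : nonempty_abelianVarietyBridge_symm W W' :=
  nonempty_abelianVarietyBridge_symm_of_full W W' (nonempty_abelianVarietyBridgeFull_holds W W')

end WeierstrassCurve
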